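import Summits.QuantumFields.BalabanUV.T4Continuum.Support.B13TermContourCore
import Summits.QuantumFields.BalabanUV.T4Continuum.Support.B13TermCoreFamily

/-!
# SUBSTRATE — THE ACTIVITY SLOT OF RECORD AS LETTERS: what the substrate supplies per factor `(Z, j)` to NE5's concrete-contour core
# `B13TermContourCore.ofContours` and term-core family `B13TermCoreFamily.actOfCores`, packaged as ONE letter record `CoreLetters`, and
# `actOfLetters` = `Slots.act` of record BY NAME (MAP item S-U3 wiring, §O1 O-3 `act`; typed: `SubstrateSketch.v0.3` §U3)

Cell `pub-balaban`, SUBSTRATE cell, seat `b2b-balaban-substrate-p1` (typer NEXT (3), the letter-level wiring; the Gaussian letters `N`, `q` read off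
the operator datum are seat p3's `SubstrateGaussianLetters`, the final record `slotsOfRecord` assembles after them).  Summits-side under the LEAN
PLACEMENT RULE.  HONEST FRAMING: rung (B)+1 of the FINITE-VOLUME T⁴ programme — NOT infinite volume, NOT a mass gap, NOT Clay; spine PROVED
0∕9.  WIRING ONLY: a letter record + two definitions by name + `rfl`; no activity of Bałaban's ([Balaban1988RG2Cluster] (2.14)) is
constructed here — the letters ARE the construction's inputs, displayed; nothing printed asserted.
HONEST DEPENDENCY (cell line, verbatim): continuum YM on T⁴ ⇐ BetaPertH ∧ nine spine estimates (0/9 proved); BetaPertH ⇐ (D1) ∧ (D4) ∧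
CAP+tail; G-an2-4 gates asym, D1 and NE2/3/4.

WHAT (sketch §U3 verbatim).  For a measurable potential frame `P : MeasPotFrame C` (of record: `SubstrateFrameOfRecord.frameOfRecordStd`),
an operator-datum type `Op`, polymer∕inner-label types `Pol`, `J`, per-factor domain families `𝒴 Z j` with `dom`, cube indices `Jc Z j` and
flat fluctuation spaces `V Z j`:
* `CoreLetters P Op 𝒴 dom Jc V Z j` — the cube-contour letter `κ₁ > 0` ((1.22) KIND), the (2.18) radii `r Y > 1`, the Gaussian letters
  `N`, `q` (read off the operator datum), the χ-constraints `cons`, the sign exponent, the field maps `B` into the frame with measurability;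
* `coreOf ℓ Z j := B13TermContourCore.ofContours …` (NE5 leaf-08's socket, p216813) — the factor's `BiCore`;
* `actOfLetters ℓ := B13TermCoreFamily.actOfCores (coreOf ℓ)` (p217394) — `Slots.act` OF RECORD; `actOfLetters_apply` (`rfl` = `termAt`).
Imports `B13TermContourCore`, `B13TermCoreFamily` (NE5 leaf-08 lineage); nothing existing is modified.
-/

noncomputable section

open _root_.MeasureTheory

namespace Summit.QuantumFields.BalabanUV.T4Continuum.SubstrateActivities

open Literature.MathematicalPhysics.QuantumFieldTheory.Balaban1983to89
open Literature.MathematicalPhysics.QuantumFieldTheory.Balaban1983to89.T4OutputRate (Carriers)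
open Summit.QuantumFields.BalabanUV.T4Continuum.B13HistMeasurable (MeasPotFrame B13HistM)
open Summit.QuantumFields.BalabanUV.T4Continuum.B13TermParamGaussianBi (BiCore)

variable {C : Carriers} (P : MeasPotFrame C) (Op : Type*) {Pol J : Type*}
  (𝒴 : Pol → J → Type) [∀ Z j, Fintype (𝒴 Z j)] (dom : ∀ Z j, 𝒴 Z j → C.Dom)
  (Jc : Pol → J → Type) [∀ Z j, Fintype (Jc Z j)]
  (V : Pol → J → Type) [∀ Z j, NormedAddCommGroup (V Z j)] [∀ Z j, InnerProductSpace ℝ (V Z j)]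
  [∀ Z j, MeasurableSpace (V Z j)] [∀ Z j, BorelSpace (V Z j)] [∀ Z j, FiniteDimensional ℝ (V Z j)]

/-- [folklore] DISPLAYED SHAPE **`CoreLetters`** (sketch v0.3 §U3 verbatim): what the substrate supplies to `ofContours` at ONE factor `(Z, j)`. -/
structure CoreLetters (Z : Pol) (j : J) where
  /-- the cube-contour letter `κ₁ > 0` ((1.22) KIND) -/
  κ₁ : ℝ
  κ₁_pos : 0 < κ₁
  /-- the (2.18) radii `r Y > 1` -/
  r : 𝒴 Z j → ℝ
  one_lt_r : ∀ Y, 1 < r Y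
  /-- Gaussian normalisation letter, read off the operator datum -/
  N : Op → ((Jc Z j ⊕ 𝒴 Z j) → ℝ × ℝ) → ℂ
  /-- Gaussian quadratic form in the flat fluctuation variable, read off the operator datum -/
  q : Op → ((Jc Z j ⊕ 𝒴 Z j) → ℝ × ℝ) → V Z j → ℂ
  /-- χ-constraints (bond read-out, threshold, small∕large flag) -/
  cons : List ((V Z j →L[ℝ] ℝ) × ℝ × Bool)
  /-- sign exponent `|P|` -/
  nsign : ℕ
  /-- field maps into the frame -/
  B : (Y : 𝒴 Z j) → V Z j → P.Arg (dom Z j Y)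
  measB : ∀ Y, Measurable (B Y)

/-- [folklore] DATA **`coreOf ℓ Z j`** (sketch verbatim): NE5's concrete-contour core built from the letters (`B13TermContourCore.ofContours` BY NAME). -/
def coreOf (ℓ : ∀ Z j, CoreLetters P Op 𝒴 dom Jc V Z j) (Z : Pol) (j : J) :
    BiCore P (dom Z j) Op ((Jc Z j ⊕ 𝒴 Z j) → ℝ × ℝ) (V Z j) :=
  B13TermContourCore.ofContours P (dom Z j) (Jc Z j) (ℓ Z j).κ₁_pos (ℓ Z j).one_lt_r (ℓ Z j).N (ℓ Z j).q (ℓ Z j).cons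
    (ℓ Z j).nsign (ℓ Z j).B (ℓ Z j).measB

/-- [folklore] DATA **`actOfLetters ℓ`** = `Slots.act` OF RECORD (sketch verbatim): `B13TermCoreFamily.actOfCores (coreOf ℓ)` — one resummed
(2.14)-integral per factor. -/
def actOfLetters (ℓ : ∀ Z j, CoreLetters P Op 𝒴 dom Jc V Z j) : Pol → J → Op → B13HistM P → ℂ :=
  B13TermCoreFamily.actOfCores (coreOf P Op 𝒴 dom Jc V ℓ)

/-- [folklore] The activity of record at `(Z, j)` IS the term of the letters' core (`rfl`). -/
theorem actOfLetters_apply (ℓ : ∀ Z j, CoreLetters P Op 𝒴 dom Jc V Z j) (Z : Pol) (j : J) (o : Op) (h : B13HistM P) :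
    actOfLetters P Op 𝒴 dom Jc V ℓ Z j o h = (coreOf P Op 𝒴 dom Jc V ℓ Z j).termAt o h := rfl

omit [∀ Z j, BorelSpace (V Z j)] [∀ Z j, FiniteDimensional ℝ (V Z j)] in
/-- [folklore] The Gaussian letters of the core of record ARE the supplied ones (so p3's `SubstrateGaussianLetters`, plugged as `ℓ.N`, `ℓ.q`,
are read by the activity unchanged). -/
theorem coreOf_N (ℓ : ∀ Z j, CoreLetters P Op 𝒴 dom Jc V Z j) (Z : Pol) (j : J) : (coreOf P Op 𝒴 dom Jc V ℓ Z j).N = (ℓ Z j).N := rfl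

omit [∀ Z j, BorelSpace (V Z j)] [∀ Z j, FiniteDimensional ℝ (V Z j)] in
/-- [folklore] Idem for the quadratic-form letter. -/
theorem coreOf_q (ℓ : ∀ Z j, CoreLetters P Op 𝒴 dom Jc V Z j) (Z : Pol) (j : J) : (coreOf P Op 𝒴 dom Jc V ℓ Z j).q = (ℓ Z j).q := rfl

omit [∀ Z j, BorelSpace (V Z j)] [∀ Z j, FiniteDimensional ℝ (V Z j)] in
/-- [folklore] Idem for the χ-constraints. -/
theorem coreOf_cons (ℓ : ∀ Z j, CoreLetters P Op 𝒴 dom Jc V Z j) (Z : Pol) (j : J) :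
    (coreOf P Op 𝒴 dom Jc V ℓ Z j).cons = (ℓ Z j).cons := rfl

end Summit.QuantumFields.BalabanUV.T4Continuum.SubstrateActivities

end
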